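import Summits.ResolutionOfSingularities.ResolutionOfSingularities.Theorems.AbsoluteQFrameWrapper
import HarnessLib

/-!
# AbsoluteQFrameRing — decomp-res node «AbsoluteContactInsep» (lens-6 g18), tree file 4/10 of the node

Content VERBATIM from the decomp-res lens-6 g18 file `HOME/decomp-res-lens-6/g18/AbsoluteContactInsep.lean` (sha256
3771488be5d3cd2c, 1966 l; HOME =
run/shared/lean/pub/decomp-res).  Critic: CRITIC-LEDGER row 139 (CLEARED 2026-08-30T20:11:48Z, DECIDED +1:
`AbsContactOff3` proved for every p ≠ 3 and every
field, hypothesis-free); split per the lens's NODE-g18 §8 writer package (sections kept whole; two packages halved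
for the 400-line limit).  Landed by
decomp-res writer g7 in the lens's namespace `…Theorems.AbsoluteContactClasses` (cone-free chain); the wiring
`Theorems/MaxContactCutAbsContactOff3`
(`agAbsContactOff3 : AGAbsContactOff3`, item 27752) follows the chain.  No new aside, nothing superseded; asides
31574 / 27753 / 27896 are ⟺ each other
hypothesis-free by this node.

Section `RingLayer` (l. 668–894).

[WRITER NOTE (decomp-res writer g7): file split only; namespace, opens, section variables and every declaration
exactly as in the lens (global `set_option` dropped).]

(Sources: Giraud1975; EGA IV 16.11.2, 0_IV 21.9; KimuraNiitsuma1980 Thm 3.4; EncinasVillamayor2000 Thm 4.9;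
BravoGarciaEscamillaVillamayor2012 Lemma 4.6; Hironaka1964; CossartJannsenSaito2020; CossartPiltant2019; Kunz1969.)
-/

noncomputable section

open CategoryTheory AlgebraicGeometry TopologicalSpace
open Literature.AlgebraicGeometry.Resolution
open Summit.ResolutionOfSingularities.ResolutionOfSingularities.Theorems
open WeakOrderReduction ForcedTowerClasses PurityValveClasses
open SatelliteExitClasses
open IsLocalRing MvPolynomial

namespace Summit.ResolutionOfSingularities.ResolutionOfSingularities.Theorems.AbsoluteContactClasses

section RingLayer

/-! ## Part B — existence of absolute `q`-frames (`hasQFrames`)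

### B.1 Frobenius-twisted evaluation `G ↦ Σ_μ (coeff_μ G)^{p^e} b^μ`, the constants subring
`R^{p^e}[b]`, reduced normal forms, and the easy half of Kunz's lemma -/

variable {R : Type*} [CommRing R]

/-- A boxed `u`-monomial times `u i`: either the next box monomial or `u i ^ q` times one. [folklore] -/
theorem u_mul_boxMon {d q : ℕ} (hq : 0 < q) (u : Fin d → R) (γ : Fin d → Fin q) (i : Fin d) :
    (∃ γ' : Fin d → Fin q, u i * boxMon q u γ = boxMon q u γ') ∨
      ∃ γ' : Fin d → Fin q, u i * boxMon q u γ = u i ^ q * boxMon q u γ' := by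
  classical
  by_cases hlt : (γ i : ℕ) + 1 < q
  · refine Or.inl ⟨Function.update γ i ⟨(γ i : ℕ) + 1, hlt⟩, ?_⟩
    rw [boxMon, boxMon, show (fun j => u j ^ ((Function.update γ i ⟨(γ i : ℕ) + 1, hlt⟩ j : Fin q) : ℕ)) =
        fun j => u j ^ Function.update (fun j => (γ j : ℕ)) i (((⟨(γ i : ℕ) + 1, hlt⟩ : Fin q)) : ℕ) j
      from by funext j; rw [← coe_update]]
    rw [prod_pow_update, prod_pow_eq_mul_erase u _ i, pow_succ]
    ring
  · have heq : (γ i : ℕ) + 1 = q := by have := (γ i).isLt; omega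
    refine Or.inr ⟨Function.update γ i ⟨0, hq⟩, ?_⟩
    rw [boxMon, boxMon, show (fun j => u j ^ ((Function.update γ i ⟨0, hq⟩ j : Fin q) : ℕ)) =
        fun j => u j ^ Function.update (fun j => (γ j : ℕ)) i (((⟨0, hq⟩ : Fin q)) : ℕ) j
      from by funext j; rw [← coe_update]]
    rw [prod_pow_update, prod_pow_eq_mul_erase u _ i, pow_zero, one_mul, ← mul_assoc, ← pow_succ', heq]

/-- Generic closure lemma: if the generators `G` multiply `M` into the `P`-span of `M`, then the
whole subring generated by `G` multiplies that span into itself. [folklore] -/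
theorem closure_mul_span_le {A : Type*} [CommRing A] (P : Subring A) (G M : Set A)
    (hG : ∀ g ∈ G, ∀ m ∈ M, g * m ∈ Submodule.span P M) :
    ∀ x ∈ Subring.closure G, ∀ w ∈ Submodule.span P M, x * w ∈ Submodule.span P M := by
  intro x hx
  let N : Subring A :=
    { carrier := {x | ∀ w ∈ Submodule.span P M, x * w ∈ Submodule.span P M}
      mul_mem' := fun {x y} hx hy w hw => by rw [mul_assoc]; exact hx _ (hy w hw)
      one_mem' := fun w hw => by rwa [one_mul]
      add_mem' := fun {x y} hx hy w hw => by rw [add_mul]; exact add_mem (hx w hw) (hy w hw)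
      zero_mem' := fun w hw => by rw [zero_mul]; exact zero_mem _
      neg_mem' := fun {x} hx w hw => by rw [neg_mul]; exact neg_mem (hx w hw) }
  have hGN : G ⊆ (N : Set A) := fun g hg w hw => by
    induction hw using Submodule.span_induction with
    | mem m hm => exact hG g hg m hm
    | zero => rw [mul_zero]; exact zero_mem _
    | add _ _ _ _ h₁ h₂ => rw [mul_add]; exact add_mem h₁ h₂
    | smul c w _ h =>
      rw [Subring.smul_def, smul_eq_mul, mul_left_comm, ← smul_eq_mul, ← Subring.smul_def]
      exact Submodule.smul_mem _ c h
  exact Subring.closure_le.mpr hGN hx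

/-- Generation of `R` by the box monomials over `Cq`, from `u i ^ q ∈ Cq` and `R = Cq[u]`. [folklore] -/
theorem top_le_span_boxMon {d q : ℕ} (hq : 0 < q) (Cq : Subring R) (u : Fin d → R)
    (hpow : ∀ i, u i ^ q ∈ Cq) (hgen : ∀ x : R, x ∈ Subring.closure ((Cq : Set R) ∪ Set.range u)) :
    ⊤ ≤ Submodule.span Cq (Set.range (boxMon q u)) := by
  classical
  intro x _
  have h1 : (1 : R) ∈ Submodule.span Cq (Set.range (boxMon q u)) :=
    Submodule.subset_span ⟨fun _ => ⟨0, hq⟩, by simp [boxMon]⟩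
  have key := closure_mul_span_le Cq ((Cq : Set R) ∪ Set.range u) (Set.range (boxMon q u)) ?_ x
    (hgen x) 1 h1
  · simpa using key
  rintro g (hg | ⟨i, rfl⟩) m ⟨γ, rfl⟩
  · have : g * boxMon q u γ = (⟨g, hg⟩ : Cq) • boxMon q u γ := rfl
    rw [this]
    exact Submodule.smul_mem _ _ (Submodule.subset_span ⟨γ, rfl⟩)
  · rcases u_mul_boxMon hq u γ i with ⟨γ', h⟩ | ⟨γ', h⟩
    · rw [h]; exact Submodule.subset_span ⟨γ', rfl⟩
    · have : u i * boxMon q u γ = (⟨u i ^ q, hpow i⟩ : Cq) • boxMon q u γ' := by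
        rw [h]; rfl
      rw [this]
      exact Submodule.smul_mem _ _ (Submodule.subset_span ⟨γ', rfl⟩)

variable (p e : ℕ) [Fact p.Prime] [CharP R p] {ι : Type*} (b : ι → R)

/-- The `b`-monomial `b^μ`. -/
def bMon (b : ι → R) (μ : ι →₀ ℕ) : R := μ.prod fun i k => b i ^ k

omit [Fact p.Prime] [CharP R p] in
/-- `bMon_add`: Auxiliary step of this node's calculus, VERBATIM from the lens file (see the module docstring); the
statement is its type. [folklore] -/
theorem bMon_add (μ ν : ι →₀ ℕ) : bMon b (μ + ν) = bMon b μ * bMon b ν :=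
  Finsupp.prod_add_index' (fun _ => pow_zero _) (fun _ _ _ => pow_add _ _ _)

omit [Fact p.Prime] [CharP R p] in
/-- `bMon_single`: Auxiliary step of this node's calculus, VERBATIM from the lens file (see the module docstring);
the statement is its type. [folklore] -/
theorem bMon_single (i : ι) (k : ℕ) : bMon b (Finsupp.single i k) = b i ^ k := by
  rw [bMon]
  exact Finsupp.prod_single_index (pow_zero _)

/-- Frobenius-twisted evaluation `G ↦ Σ_μ (coeff_μ G)^{p^e} · b^μ`. -/
def frobEval : MvPolynomial ι R →+* R := eval₂Hom (iterateFrobenius R p e) b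

/-- `frobEval_monomial`: Auxiliary step of this node's calculus, VERBATIM from the lens file (see the module
docstring); the statement is its type. [folklore] -/
theorem frobEval_monomial (μ : ι →₀ ℕ) (a : R) :
    frobEval p e b (monomial μ a) = a ^ p ^ e * bMon b μ := by
  rw [frobEval, coe_eval₂Hom, eval₂_monomial, iterateFrobenius_def]; rfl

/-- `frobEval_C`: Auxiliary step of this node's calculus, VERBATIM from the lens file (see the module docstring);
the statement is its type. [folklore] -/
theorem frobEval_C (a : R) : frobEval p e b (C a) = a ^ p ^ e := by
  rw [frobEval, coe_eval₂Hom, eval₂_C, iterateFrobenius_def]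

/-- `frobEval_X`: Auxiliary step of this node's calculus, VERBATIM from the lens file (see the module docstring);
the statement is its type. [folklore] -/
theorem frobEval_X (i : ι) : frobEval p e b (X i) = b i := by
  rw [frobEval, coe_eval₂Hom, eval₂_X]

/-- `frobEval_apply`: Auxiliary step of this node's calculus, VERBATIM from the lens file (see the module
docstring); the statement is its type. [folklore] -/
theorem frobEval_apply (G : MvPolynomial ι R) :
    frobEval p e b G = ∑ μ ∈ G.support, coeff μ G ^ p ^ e * bMon b μ := by
  conv_lhs => rw [G.as_sum]
  rw [map_sum]
  exact Finset.sum_congr rfl fun μ _ => frobEval_monomial p e b μ _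

/-- The constants subring `Cq = R^{p^e}[b]` (the image of the Frobenius-twisted evaluation). -/
def frobSubring : Subring R := (frobEval p e b).range

/-- `pow_mem_frobSubring`: Auxiliary step of this node's calculus, VERBATIM from the lens file (see the module
docstring); the statement is its type. [folklore] -/
theorem pow_mem_frobSubring (r : R) : r ^ p ^ e ∈ frobSubring p e b :=
  ⟨C r, frobEval_C p e b r⟩

/-- `apply_mem_frobSubring`: Auxiliary step of this node's calculus, VERBATIM from the lens file (see the module
docstring); the statement is its type. [folklore] -/
theorem apply_mem_frobSubring (i : ι) : b i ∈ frobSubring p e b :=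
  ⟨X i, frobEval_X p e b i⟩

omit [Fact p.Prime] [CharP R p] in
/-- Reduced polynomials: all exponents `< q`. -/
def IsReduced (q : ℕ) (G : MvPolynomial ι R) : Prop := ∀ μ ∈ G.support, ∀ i, μ i < q

omit [Fact p.Prime] [CharP R p] in
/-- `IsReduced.add`: Auxiliary step of this node's calculus, VERBATIM from the lens file (see the module docstring);
the statement is its type. [folklore] -/
theorem IsReduced.add {q : ℕ} {G₁ G₂ : MvPolynomial ι R} (h₁ : IsReduced q G₁) (h₂ : IsReduced q G₂) :
    IsReduced q (G₁ + G₂) := by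
  classical
  intro μ hμ i
  rcases Finset.mem_union.mp (support_add hμ) with h | h
  · exact h₁ μ h i
  · exact h₂ μ h i

omit [Fact p.Prime] [CharP R p] in
/-- `IsReduced.sum`: Auxiliary step of this node's calculus, VERBATIM from the lens file (see the module docstring);
the statement is its type. [folklore] -/
theorem IsReduced.sum {q : ℕ} {α : Type*} (s : Finset α) (G : α → MvPolynomial ι R)
    (h : ∀ a ∈ s, IsReduced q (G a)) : IsReduced q (∑ a ∈ s, G a) := by
  classical
  induction s using Finset.induction_on with
  | empty => intro μ hμ; simp at hμ
  | insert a s ha ih =>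
    rw [Finset.sum_insert ha]
    exact (h a (Finset.mem_insert_self a s)).add (ih fun x hx => h x (Finset.mem_insert_of_mem hx))

omit [Fact p.Prime] [CharP R p] in
/-- `isReduced_monomial`: Auxiliary step of this node's calculus, VERBATIM from the lens file (see the module
docstring); the statement is its type. [folklore] -/
theorem isReduced_monomial {q : ℕ} {μ : ι →₀ ℕ} (hμ : ∀ i, μ i < q) (a : R) :
    IsReduced q (monomial μ a) := by
  classical
  intro ν hν i
  have := support_monomial_subset hν
  rw [Finset.mem_singleton] at this
  subst this
  exact hμ i

/-- **Reduced normal forms**: every element of `R^{p^e}[b]` is `Σ_μ r_μ^{p^e} b^μ` with all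
exponents `< p^e` (using `b_i^{p^e} = (b_i)^{p^e} · 1`). [folklore] -/
theorem exists_isReduced (G : MvPolynomial ι R) :
    ∃ G', IsReduced (p ^ e) G' ∧ frobEval p e b G' = frobEval p e b G := by
  classical
  have hq : 0 < p ^ e := pow_pos (Fact.out : p.Prime).pos e
  induction G using MvPolynomial.induction_on with
  | C a =>
    refine ⟨C a, fun μ hμ i => ?_, rfl⟩
    have : μ = 0 := by
      by_contra hne
      exact (mem_support_iff.mp hμ) (by rw [coeff_C, if_neg (Ne.symm hne)])
    subst this
    simpa using hq
  | add G₁ G₂ ih₁ ih₂ =>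
    obtain ⟨G₁', h₁, e₁⟩ := ih₁
    obtain ⟨G₂', h₂, e₂⟩ := ih₂
    exact ⟨G₁' + G₂', h₁.add h₂, by rw [map_add, map_add, e₁, e₂]⟩
  | mul_X G i ih =>
    obtain ⟨G', hG', eG⟩ := ih
    refine ⟨∑ μ ∈ G'.support, if μ i + 1 < p ^ e then monomial (μ + Finsupp.single i 1) (coeff μ G')
        else monomial (μ.erase i) (coeff μ G' * b i), ?_, ?_⟩
    · refine IsReduced.sum _ _ fun μ hμ => ?_
      split_ifs with hlt
      · refine isReduced_monomial (fun j => ?_) _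
        by_cases hji : j = i
        · subst hji; simpa using hlt
        · simp only [Finsupp.coe_add, Pi.add_apply, Finsupp.single_apply, if_neg (Ne.symm hji), add_zero]
          exact hG' μ hμ j
      · refine isReduced_monomial (fun j => ?_) _
        by_cases hji : j = i
        · subst hji; simpa using hq
        · rw [Finsupp.erase_ne hji]; exact hG' μ hμ j
    · rw [map_mul, ← eG, map_sum, frobEval_apply p e b G', Finset.sum_mul, frobEval_X]
      refine Finset.sum_congr rfl fun μ hμ => ?_
      split_ifs with hlt
      · rw [frobEval_monomial, bMon_add, bMon_single, pow_one, mul_assoc]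
      · have hμi : μ i + 1 = p ^ e := by have := hG' μ hμ i; omega
        have hsplit : bMon b μ = b i ^ μ i * bMon b (μ.erase i) := by
          conv_lhs => rw [← Finsupp.single_add_erase i μ]
          rw [bMon_add, bMon_single]
        rw [frobEval_monomial, hsplit, mul_pow, ← hμi]
        ring

/-- Membership in the constants subring through a reduced polynomial. [folklore] -/
theorem exists_isReduced_of_mem {c : R} (hc : c ∈ frobSubring p e b) :
    ∃ G, IsReduced (p ^ e) G ∧ frobEval p e b G = c := by
  obtain ⟨G₀, rfl⟩ := hc
  exact exists_isReduced p e b G₀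

/-- **`q`-independence of a family in the linear (Kunz) form** (typically in a field `K` of
characteristic `p`, `q = p^e`): a vanishing `K^q`-combination of reduced monomials has zero
coefficients. -/
def QIndep {K : Type*} [CommRing K] (q : ℕ) {ι : Type*} (v : ι → K) : Prop :=
  ∀ (s : Finset (ι →₀ ℕ)) (c : (ι →₀ ℕ) → K), (∀ μ ∈ s, ∀ i, μ i < q) →
    ∑ μ ∈ s, c μ ^ q * μ.prod (fun i k => v i ^ k) = 0 → ∀ μ ∈ s, c μ = 0

variable [IsLocalRing R]

/-- **Easy half of Kunz's lemma**: if the residues of `b` are `p^e`-independent and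
`Σ_μ r_μ^{p^e} b^μ ∈ 𝔪` with reduced exponents, then every `r_μ ∈ 𝔪`. [folklore] -/
theorem coeff_mem_maximalIdeal_of_frobEval_mem
    (hT : QIndep (p ^ e) (fun i => residue R (b i))) {G : MvPolynomial ι R}
    (hG : IsReduced (p ^ e) G) (hm : frobEval p e b G ∈ maximalIdeal R) (μ : ι →₀ ℕ) :
    coeff μ G ∈ maximalIdeal R := by
  classical
  by_cases hμ : μ ∈ G.support
  · rw [← residue_eq_zero_iff]
    refine hT G.support (fun μ => residue R (coeff μ G)) hG ?_ μ hμ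
    have h0 := (residue_eq_zero_iff _).mpr hm
    rw [frobEval_apply, map_sum] at h0
    rw [← h0]
    refine Finset.sum_congr rfl fun ν _ => ?_
    rw [map_mul, map_pow, bMon, Finsupp.prod, Finsupp.prod, map_prod]
    simp only [map_pow]
  · rw [notMem_support_iff.mp hμ]
    exact zero_mem _

end RingLayer

end Summit.ResolutionOfSingularities.ResolutionOfSingularities.Theorems.AbsoluteContactClasses
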